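import Summits.CriticalPhenomena.CardyFormulaZ2.Theorems.CardyIKTransportIKMixedBoxCrossingDefectStubRowTwist

/-!
# Helper `noiseOp_variance_le` (hypercube noise-operator variance contraction) for the line
# `defect-closure-exploration` (crux `IKMixedBoxCrossing`, stmt-CriticalPhenomena-5911)

Support file (`--supports stmt-CriticalPhenomena-5911`), ingredient (W-a) of the exterior-row `L²`
robustness theorem. On the hypercube `Fin n → Bool` with coordinate-dependent flip probabilities
`p : Fin n → [0, 1]`, the NOISE OPERATOR is

  `(T_p f)(s) = Σ_ε w(ε) f(s ⊕ ε)`, `w(ε) = ∏_i (if ε i then p i else 1 - p i)`,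

and the claim is the variance contraction (uniform average `𝔼`, `Var g = 𝔼 (g - 𝔼 g)²`)

  `Var (T_p f) ≤ r² · Var f` whenever `|1 - 2 p_i| ≤ r` for all `i`.

Proof (Walsh expansion, everything a finite sum). With `σ b = if b then -1 else 1` and the Walsh products
`χ_S(s) = ∏_{i ∈ S} σ(s i)` (`S : Fin n → Bool`):
* dual orthogonality `Σ_S χ_S(s) χ_S(t) = 2^n [s = t]` (a product of the one-coordinate sums
  `σ(s i) σ(t i) + 1`, `Fintype.prod_sum`), whence Parseval `Σ_S (Σ_s g s χ_S s)² = 2^n Σ_s g(s)²` and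
  `Var g = Σ_{S ≠ ∅} ĝ(S)²`, `ĝ(S) = (Σ_s g s χ_S s) / 2^n` (the `S = ∅` coefficient is the mean);
* the Walsh products are eigenfunctions, `Σ_ε w(ε) χ_S(u ⊕ ε) = ρ_S χ_S(u)` with
  `ρ_S = ∏_{i ∈ S} (1 - 2 p_i)` (again a product of one-coordinate sums), so that, `T_p` being symmetric
  (`s ↦ s ⊕ ε` is an involution of the cube), `(T_p f)^(S) = ρ_S f̂(S)`;
* `ρ_S² ≤ r²` for `S ≠ ∅`: one factor is `≤ r²`, the others are in `[0, 1]`.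
Hence `Var (T_p f) = Σ_{S ≠ ∅} ρ_S² f̂(S)² ≤ r² Σ_{S ≠ ∅} f̂(S)² = r² Var f`.
-/

namespace Summit.CriticalPhenomena.CardyFormulaZ2.Cruxes.IKMixedBoxCrossing.DefectClosureExploration

open scoped Classical BigOperators
open Finset

namespace NoiseOpStub

/-! ## §1 Walsh products: dual orthogonality and Parseval -/

/-- Dual orthogonality in product form: `Σ_S χ_S(s) χ_S(t) = ∏_i (σ(s i) σ(t i) + 1)`. -/
theorem walsh_sum_mul_eq_prod (n : ℕ) (s t : Fin n → Bool) :
    ∑ S : Fin n → Bool, (∏ i, if S i then (if s i then (-1 : ℝ) else 1) else 1) *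
        (∏ i, if S i then (if t i then (-1 : ℝ) else 1) else 1) =
      ∏ i : Fin n, ((if s i then (-1 : ℝ) else 1) * (if t i then (-1 : ℝ) else 1) + 1) := by
  calc ∑ S : Fin n → Bool, (∏ i, if S i then (if s i then (-1 : ℝ) else 1) else 1) *
        (∏ i, if S i then (if t i then (-1 : ℝ) else 1) else 1)
      = ∑ S : Fin n → Bool, ∏ i, (if S i then (if s i then (-1 : ℝ) else 1) *
          (if t i then (-1 : ℝ) else 1) else 1) := by
        refine Finset.sum_congr rfl fun S _ => ?_
        rw [← Finset.prod_mul_distrib]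
        refine Finset.prod_congr rfl fun i _ => ?_
        cases S i <;> simp
    _ = ∏ i : Fin n, ∑ b : Bool, (if b then (if s i then (-1 : ℝ) else 1) *
          (if t i then (-1 : ℝ) else 1) else 1) :=
        (Fintype.prod_sum fun (i : Fin n) (b : Bool) =>
          if b then (if s i then (-1 : ℝ) else 1) * (if t i then (-1 : ℝ) else 1) else 1).symm
    _ = ∏ i : Fin n, ((if s i then (-1 : ℝ) else 1) * (if t i then (-1 : ℝ) else 1) + 1) := by
        refine Finset.prod_congr rfl fun i _ => ?_
        rw [Fintype.sum_bool]
        simp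

/-- Dual orthogonality, diagonal case: `Σ_S χ_S(s)² = 2^n`. -/
theorem walsh_sum_mul_self (n : ℕ) (s : Fin n → Bool) :
    ∑ S : Fin n → Bool, (∏ i, if S i then (if s i then (-1 : ℝ) else 1) else 1) *
        (∏ i, if S i then (if s i then (-1 : ℝ) else 1) else 1) = 2 ^ n := by
  rw [walsh_sum_mul_eq_prod]
  have h : ∀ i, (if s i then (-1 : ℝ) else 1) * (if s i then (-1 : ℝ) else 1) + 1 = 2 := fun i => by
    cases s i <;> norm_num
  simp only [h, Finset.prod_const, Finset.card_univ, Fintype.card_fin]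

/-- Dual orthogonality, off-diagonal case: `Σ_S χ_S(s) χ_S(t) = 0` for `s ≠ t`. -/
theorem walsh_sum_mul_of_ne (n : ℕ) (s t : Fin n → Bool) (hst : s ≠ t) :
    ∑ S : Fin n → Bool, (∏ i, if S i then (if s i then (-1 : ℝ) else 1) else 1) *
        (∏ i, if S i then (if t i then (-1 : ℝ) else 1) else 1) = 0 := by
  rw [walsh_sum_mul_eq_prod]
  obtain ⟨i, hi⟩ := Function.ne_iff.mp hst
  refine Finset.prod_eq_zero (Finset.mem_univ i) ?_
  revert hi
  cases s i <;> cases t i <;> norm_num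

/-- Abstract Parseval identity: if the family `χ S`, `S : β`, satisfies the dual orthogonality relations
`Σ_S χ_S(s) χ_S(s) = N` and `Σ_S χ_S(s) χ_S(t) = 0` (`s ≠ t`), then `Σ_S (Σ_s g s χ_S s)² = N Σ_s g(s)²`. -/
theorem sum_sq_sum_mul_eq {α β : Type*} [Fintype α] [Fintype β] (χ : β → α → ℝ) (N : ℝ)
    (hdiag : ∀ s, ∑ S, χ S s * χ S s = N) (hoff : ∀ s t, s ≠ t → ∑ S, χ S s * χ S t = 0)
    (g : α → ℝ) : ∑ S, (∑ s, g s * χ S s) ^ 2 = N * ∑ s, g s ^ 2 := by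
  calc ∑ S, (∑ s, g s * χ S s) ^ 2
      = ∑ S, ∑ s, ∑ t, g s * g t * (χ S s * χ S t) := by
        refine Finset.sum_congr rfl fun S _ => ?_
        rw [sq, Finset.sum_mul_sum]
        exact Finset.sum_congr rfl fun s _ => Finset.sum_congr rfl fun t _ => by ring
    _ = ∑ s, ∑ t, g s * g t * ∑ S, χ S s * χ S t := by
        rw [Finset.sum_comm]
        refine Finset.sum_congr rfl fun s _ => ?_
        rw [Finset.sum_comm]
        refine Finset.sum_congr rfl fun t _ => ?_
        rw [Finset.mul_sum]
    _ = ∑ s, g s * g s * N := by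
        refine Finset.sum_congr rfl fun s _ => ?_
        rw [Fintype.sum_eq_single s fun t hts => by rw [hoff s t (Ne.symm hts), mul_zero], hdiag]
    _ = N * ∑ s, g s ^ 2 := by
        rw [Finset.mul_sum]
        exact Finset.sum_congr rfl fun s _ => by ring

/-- Expansion of the sum of squared deviations from the mean on the cube:
`Σ_s (g s - m)² = Σ_s g(s)² - (Σ g)² / 2^n`, `m = (Σ g) / 2^n`. -/
theorem sum_sq_sub_mean (n : ℕ) (g : (Fin n → Bool) → ℝ) :
    ∑ s, (g s - (∑ t, g t) / 2 ^ n) ^ 2 = ∑ s, g s ^ 2 - (∑ t, g t) ^ 2 / 2 ^ n := by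
  have hN : (2 : ℝ) ^ n ≠ 0 := by positivity
  have hcard : ((univ : Finset (Fin n → Bool)).card : ℝ) = 2 ^ n := by
    exact_mod_cast (show (univ : Finset (Fin n → Bool)).card = 2 ^ n by simp)
  simp only [sub_sq, Finset.sum_add_distrib, Finset.sum_sub_distrib, Finset.sum_const, nsmul_eq_mul,
    hcard]
  rw [show ∑ s : Fin n → Bool, 2 * g s * ((∑ t, g t) / 2 ^ n) = 2 * (∑ s, g s) * ((∑ t, g t) / 2 ^ n) by
    rw [Finset.mul_sum, Finset.sum_mul]]
  field_simp
  ring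

/-- Variance in terms of the non-constant Walsh coefficients:
`(Σ_s (g s - m)²) / 2^n = Σ_{S ≠ ∅} ĝ(S)²`, `ĝ(S) = (Σ_s g s χ_S s) / 2^n`, `m = (Σ g) / 2^n`. -/
theorem var_eq_sum_coef_sq (n : ℕ) (g : (Fin n → Bool) → ℝ) :
    (∑ s, (g s - (∑ t, g t) / 2 ^ n) ^ 2) / 2 ^ n =
      ∑ S ∈ (univ : Finset (Fin n → Bool)).erase (fun _ => false),
        ((∑ s, g s * ∏ i, if S i then (if s i then (-1 : ℝ) else 1) else 1) / 2 ^ n) ^ 2 := by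
  have hN : (2 : ℝ) ^ n ≠ 0 := by positivity
  have parseval : ∑ S : Fin n → Bool,
      (∑ s, g s * ∏ i, if S i then (if s i then (-1 : ℝ) else 1) else 1) ^ 2 = 2 ^ n * ∑ s, g s ^ 2 :=
    sum_sq_sum_mul_eq (fun (S s : Fin n → Bool) => ∏ i, if S i then (if s i then (-1 : ℝ) else 1) else 1)
      (2 ^ n) (walsh_sum_mul_self n) (walsh_sum_mul_of_ne n) g
  rw [Finset.sum_erase_eq_sub (Finset.mem_univ _)]
  have h0 : (∑ s, g s * ∏ i : Fin n,
      if (fun _ : Fin n => false) i then (if s i then (-1 : ℝ) else 1) else 1) = ∑ t, g t := by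
    simp
  rw [h0]
  simp_rw [div_pow]
  rw [← Finset.sum_div, parseval, sum_sq_sub_mean]
  field_simp

/-! ## §2 The noise operator on Walsh products -/

/-- The Walsh products are eigenfunctions of the noise operator:
`Σ_ε w(ε) χ_S(u ⊕ ε) = ρ_S χ_S(u)`, `ρ_S = ∏_{i ∈ S} (1 - 2 p_i)`. -/
theorem noise_walsh (n : ℕ) (p : Fin n → ℝ) (S u : Fin n → Bool) :
    ∑ ε : Fin n → Bool, (∏ i, if ε i then p i else 1 - p i) *
        (∏ i, if S i then (if xor (u i) (ε i) then (-1 : ℝ) else 1) else 1) =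
      (∏ i, if S i then 1 - 2 * p i else 1) *
        (∏ i, if S i then (if u i then (-1 : ℝ) else 1) else 1) := by
  calc ∑ ε : Fin n → Bool, (∏ i, if ε i then p i else 1 - p i) *
        (∏ i, if S i then (if xor (u i) (ε i) then (-1 : ℝ) else 1) else 1)
      = ∑ ε : Fin n → Bool, ∏ i, ((if ε i then p i else 1 - p i) *
          (if S i then (if xor (u i) (ε i) then (-1 : ℝ) else 1) else 1)) := by
        refine Finset.sum_congr rfl fun ε _ => ?_
        rw [Finset.prod_mul_distrib]
    _ = ∏ i, ∑ b : Bool, ((if b then p i else 1 - p i) *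
          (if S i then (if xor (u i) b then (-1 : ℝ) else 1) else 1)) :=
        (Fintype.prod_sum fun (i : Fin n) (b : Bool) =>
          (if b then p i else 1 - p i) * (if S i then (if xor (u i) b then (-1 : ℝ) else 1) else 1)).symm
    _ = ∏ i, ((if S i then 1 - 2 * p i else 1) * (if S i then (if u i then (-1 : ℝ) else 1) else 1)) := by
        refine Finset.prod_congr rfl fun i _ => ?_
        rw [Fintype.sum_bool]
        cases S i <;> cases u i <;> simp <;> ring
    _ = (∏ i, if S i then 1 - 2 * p i else 1) *
          (∏ i, if S i then (if u i then (-1 : ℝ) else 1) else 1) := Finset.prod_mul_distrib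

/-- Symmetry transfer: if `s ↦ act s e` is an involution for every `e` and `χ` is an eigenfunction of the
kernel `f ↦ (s ↦ Σ_e w(e) f(act s e))` with eigenvalue `ρ`, then `Σ_s (Σ_e w e f(act s e)) χ(s) = ρ Σ_s f s χ s`. -/
theorem sum_noise_mul_eq {α E : Type*} [Fintype α] [Fintype E] (act : α → E → α)
    (hact : ∀ s e, act (act s e) e = s) (w : E → ℝ) (χ : α → ℝ) (ρ : ℝ)
    (heig : ∀ u, ∑ e, w e * χ (act u e) = ρ * χ u) (f : α → ℝ) :
    ∑ s, (∑ e, w e * f (act s e)) * χ s = ρ * ∑ s, f s * χ s := by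
  calc ∑ s, (∑ e, w e * f (act s e)) * χ s
      = ∑ s, ∑ e, w e * f (act s e) * χ s := by simp_rw [Finset.sum_mul]
    _ = ∑ e, ∑ s, w e * f (act s e) * χ s := Finset.sum_comm
    _ = ∑ e, ∑ u, w e * f u * χ (act u e) := by
        refine Finset.sum_congr rfl fun e _ => ?_
        exact Fintype.sum_equiv (Function.Involutive.toPerm (fun s => act s e) fun s => hact s e) _ _
          fun s => by simp only [Function.Involutive.coe_toPerm, hact]
    _ = ∑ u, ∑ e, w e * f u * χ (act u e) := Finset.sum_comm
    _ = ∑ u, f u * ∑ e, w e * χ (act u e) := by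
        refine Finset.sum_congr rfl fun u _ => ?_
        rw [Finset.mul_sum]
        exact Finset.sum_congr rfl fun e _ => by ring
    _ = ρ * ∑ s, f s * χ s := by
        rw [Finset.mul_sum]
        exact Finset.sum_congr rfl fun u _ => by rw [heig]; ring

/-- Eigenvalue bound: for `S ≠ ∅` and `|1 - 2 p_i| ≤ r`, `0 ≤ p_i ≤ 1`, one has `ρ_S² ≤ r²`. -/
theorem rho_sq_le (n : ℕ) (p : Fin n → ℝ) (r : ℝ) (hp : ∀ i, 0 ≤ p i ∧ p i ≤ 1 ∧ |1 - 2 * p i| ≤ r)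
    (S : Fin n → Bool) (hS : S ≠ fun _ => false) :
    (∏ i, if S i then 1 - 2 * p i else 1) ^ 2 ≤ r ^ 2 := by
  obtain ⟨i₀, hi₀⟩ : ∃ i, S i = true := by
    by_contra h
    exact hS (funext fun i => by simpa using fun hi => h ⟨i, hi⟩)
  rw [← Finset.prod_pow, ← Finset.mul_prod_erase univ _ (Finset.mem_univ i₀)]
  have h1 : (if S i₀ then 1 - 2 * p i₀ else 1) ^ 2 ≤ r ^ 2 := by
    rw [if_pos hi₀]
    have h := (hp i₀).2.2
    rw [abs_le] at h
    exact sq_le_sq' h.1 h.2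
  have h2 : ∏ i ∈ univ.erase i₀, (if S i then 1 - 2 * p i else 1) ^ 2 ≤ 1 := by
    refine Finset.prod_le_one (fun i _ => sq_nonneg _) fun i _ => ?_
    split_ifs
    · have h := hp i
      nlinarith [h.1, h.2.1]
    · simp
  calc (if S i₀ then 1 - 2 * p i₀ else 1) ^ 2 * ∏ i ∈ univ.erase i₀, (if S i then 1 - 2 * p i else 1) ^ 2
      ≤ r ^ 2 * 1 := mul_le_mul h1 h2 (Finset.prod_nonneg fun i _ => sq_nonneg _) (sq_nonneg r)
    _ = r ^ 2 := mul_one _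

end NoiseOpStub

/-- (W-a) NOISE-OPERATOR VARIANCE CONTRACTION on the hypercube (Bool/XOR form, coordinate-dependent flip
probabilities `p i ∈ [0, 1]` with `|1 - 2 p i| ≤ r`): `Var (T_p f) ≤ r² · Var f`, where
`(T_p f)(s) = Σ_ε (∏_i if ε i then p i else 1 - p i) f(s ⊕ ε)` and `Var g = (Σ_s (g s - (Σ g)/2^n)²)/2^n`. -/
theorem noiseOp_variance_le : ∀ (n : ℕ) (p : Fin n → ℝ) (r : ℝ),
    (∀ i, 0 ≤ p i ∧ p i ≤ 1 ∧ |1 - 2 * p i| ≤ r) → ∀ f : (Fin n → Bool) → ℝ,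
    (∑ s : Fin n → Bool, ((∑ ε : Fin n → Bool, (∏ i, if ε i then p i else 1 - p i) * f (fun i => xor (s i) (ε i)))
        - (∑ t : Fin n → Bool, ∑ ε : Fin n → Bool, (∏ i, if ε i then p i else 1 - p i) * f (fun i => xor (t i) (ε i))) / 2 ^ n) ^ 2) / 2 ^ n
      ≤ r ^ 2 * ((∑ s : Fin n → Bool, (f s - (∑ t : Fin n → Bool, f t) / 2 ^ n) ^ 2) / 2 ^ n) := by
  intro n p r hp f
  rw [NoiseOpStub.var_eq_sum_coef_sq n (fun s => ∑ ε : Fin n → Bool,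
      (∏ i, if ε i then p i else 1 - p i) * f (fun i => xor (s i) (ε i))),
    NoiseOpStub.var_eq_sum_coef_sq n f, Finset.mul_sum]
  refine Finset.sum_le_sum fun S hS => ?_
  have hS0 : S ≠ fun _ => false := Finset.ne_of_mem_erase hS
  rw [NoiseOpStub.sum_noise_mul_eq (fun (s ε : Fin n → Bool) (i : Fin n) => xor (s i) (ε i))
      (fun s ε => funext fun i => by simp) (fun ε => ∏ i, if ε i then p i else 1 - p i)
      (fun s => ∏ i, if S i then (if s i then (-1 : ℝ) else 1) else 1)
      (∏ i, if S i then 1 - 2 * p i else 1) (NoiseOpStub.noise_walsh n p S) f,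
    mul_div_assoc, mul_pow]
  exact mul_le_mul_of_nonneg_right (NoiseOpStub.rho_sq_le n p r hp S hS0) (sq_nonneg _)

end Summit.CriticalPhenomena.CardyFormulaZ2.Cruxes.IKMixedBoxCrossing.DefectClosureExploration
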